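import Summits.BirchSwinnertonDyer.BirchSwinnertonDyer.Theses.SchneiderFreeAdditiveX3
import Summits.BirchSwinnertonDyer.Rank1Residual.X11b.TamagawaHeegnerExact
import Summits.BirchSwinnertonDyer.Rank1Residual.X11b.AnticyclotomicLinks
import Literature.NumberTheory.EllipticCurves.BSDQuadraticDescentTorsionOddPartProofs
import HarnessLib

/-!
# Route `SchneiderFreeAdditiveX3` (rung K1 door): the link «cruxes r2 ∧ r3 ∧ r4 ⟹ target StepLManin»
# PROVED modulo Kolyvagin's finiteness of `Ш(E/K)` (support `StepLManinLink`, item 19179, frame plumbing)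

Seat `bsd-schneider-door-c2` (prover). The route's support item `StepLManinLink :=
PotMultBranchIMC → GordTwoBranchIMC → AnticycControlAdditive → StepLManin` is the glue that turns the
three analytic cruxes into the target. This file supplies the FRAME PLUMBING the route header lists as
«not decomposed yet» and proves the link with ONE printed fact as an explicit antecedent:

* an anticyclotomic `ℤ_p`-extension of the Heegner field with a topological generator
  (`X11b.exists_anticyclotomic_generator_prime`, from the tree theorem `exists_anticyclotomic_holds`);
* a degree-one prime `𝔭 ∣ p` (`X11b.exists_degreeOnePrime_of_splitsIn`; `p` splits in `K` because `p`
  is additive, so `p ∣ N_E`, and `K` satisfies the Heegner hypothesis for `N_E`);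
* the Tamagawa transport at a classical Heegner field for EVERY `p`
  (`X11b.padicValNat_tamagawaProductSplit_eq_of_heegner_prime`,
  `X11b.padicValNat_tamagawaProduct_baseChange_of_heegner_prime`: `ord_p ∏_{w∣N⁺} c_w(E/K) =
  ord_p ∏_w c_w(E/K) = 2·ord_p ∏_ℓ c_ℓ(E)`);
* `ord_p #Ш(E/K)[p^∞] = ord_p #Ш(E/K)` — which needs `Ш(E/K)` FINITE. The target's currency is
  `(W.baseChange K).shaOrder = Nat.card Ш(E/K)` (junk `0` when infinite), the cruxes' currency is
  `Nat.card Ш(E/K)[p^∞]`; the passage is Kolyvagin's theorem (`Literature…kolyvagin N W K`: a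
  non-torsion Heegner point forces `Ш(E/K)` finite), a named fact that NO antecedent of
  `StepLManinLink` supplies. Hence:

`stepLManin_of_kolyvagin_of_cruxes : (∀ N W K, kolyvagin N W K) → PotMultBranchIMC →
GordTwoBranchIMC → AnticycControlAdditive → StepLManin` (all four consequents are the route's decls BY
NAME), and `stepLManinLink_of_kolyvagin : (∀ N W K, kolyvagin N W K) → StepLManinLink`.

FINDING for the planner (closability, same kind as the v16 note on `HeegnerTwistData`): as typed,
`StepLManinLink` (item 19179) is not provable in the tree without a finiteness input for `Ш(E/K)`;
the repair is to prepend the Kolyvagin conjunct of `PrintedFacts` (which `closes` already holds as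
`hKo`) — `StepLManinLink := (∀ N W K, kolyvagin N W K) → PotMultBranchIMC → …` — or to read
`StepLManin` in `Ш[p^∞]`-currency. Nothing here proves a crux; BSD is not advanced; the door's open
inputs remain r2, r3, r4.

References: [JetchevSkinnerWan2017] §7.3.1 (eq:tamK), §7.4.1 (eq:shalowerK-1) (arXiv:1512.06894
p. 30); [Gross1991] Thm. 1.3 (Kolyvagin); [GreenbergLNM1716] §1.
-/

noncomputable section

open scoped Classical

open WeierstrassCurve NumberField IsDedekindDomain Field Literature.NumberTheory.EllipticCurves
  Literature.NumberTheory.EllipticCurves.ModularForms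
  Literature.NumberTheory.EllipticCurves.GreenbergSelmer
  Literature.NumberTheory.EllipticCurves.Rank1Residual
  Literature.NumberTheory.EllipticCurves.Rank1Residual.Typed
  Summit.BirchSwinnertonDyer.Rank1Residual
  Summit.BirchSwinnertonDyer.Rank1Residual.X11b
  Summit.BirchSwinnertonDyer.Rank1Residual.X11b.AcSelmer
  Summit.BirchSwinnertonDyer.Rank1Residual.X11b.Halves
  Summit.BirchSwinnertonDyer.BirchSwinnertonDyer.Theses.SchneiderFreeAdditiveX3

set_option autoImplicit false
set_option linter.dupNamespace false

namespace Summit.BirchSwinnertonDyer.BirchSwinnertonDyer.Theorems.SchneiderFree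

/-- **From the frame statements to STEP L over `K`, at one Heegner datum, given `Ш(E/K)` finite.**
At an odd additive `p` on the N10 locus and a classical Heegner field `K` for `N_E`: a frame
`(κ, γ, 𝔭)` with `𝔭 ∣ p` of degree one EXISTS, and the slack-`s` link T-B6-1 with the control equality
T-B6-2′ at that frame give `IndexLowerBoundLeAt W p K P s`, by the tree's bookkeeping
`index_le_slack_of_additive_links`, the Tamagawa transport for every `p`, and
`ord_p #Ш(E/K)[p^∞] = ord_p #Ш(E/K)` for finite `Ш`. [cite: JetchevSkinnerWan2017, §7.4.1 (arXiv p. 30)] -/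
theorem indexLowerBoundLeAt_of_frames_of_shaFinite {W : WeierstrassCurve ℚ} [W.IsElliptic]
    [W.IsGloballyMinimal] {p : ℕ} [Fact p.Prime] {N : ℕ} {K : Type} [Field K] [NumberField K]
    {P : (W.baseChange K).toAffine.Point} {s : ℕ}
    (hloc : Additive.N10.Locus W p) (hN : W.conductorNorm ℤ = N) (hK : IsImaginaryQuadratic K)
    (hHe : SatisfiesHeegnerHypothesis N K) (hfin : (W.baseChange K).ShaFinite)
    (h1 : ∀ (κ : ZpExtension K p), κ.IsAnticyclotomic →
      ∀ (γ : Field.absoluteGaloisGroup K) [Fact (κ.IsTopGenerator γ)]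
        (𝔭 : HeightOneSpectrum (𝓞 K)) (h𝔭 : ((p : ℕ) : 𝓞 K) ∈ 𝔭.asIdeal)
        (he : 𝔭.asIdeal.ramificationIdx (𝓞 ℚ) = 1) (hf : 𝔭.asIdeal.inertiaDeg (𝓞 ℚ) = 1),
        AdditiveIMCLowerBDPOnTreeLeAt p κ 𝔭 γ (embAt K p 𝔭 h𝔭 he hf) s P)
    (h2 : ∀ (κ : ZpExtension K p), κ.IsAnticyclotomic →
      ∀ (γ : Field.absoluteGaloisGroup K) [Fact (κ.IsTopGenerator γ)]
        (𝔭 : HeightOneSpectrum (𝓞 K)) (h𝔭 : ((p : ℕ) : 𝓞 K) ∈ 𝔭.asIdeal)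
        (he : 𝔭.asIdeal.ramificationIdx (𝓞 ℚ) = 1) (hf : 𝔭.asIdeal.inertiaDeg (𝓞 ℚ) = 1),
        AdditiveControlOnTreeAt p κ 𝔭 γ (embAt K p 𝔭 h𝔭 he hf) P) :
    IndexLowerBoundLeAt W p K P s := by
  have hp : p.Prime := Fact.out
  -- `p` is additive, so `p ∣ N_E`, so `p` splits in the Heegner field `K`
  have hpN : p ∣ W.conductorNorm ℤ :=
    (W.dvd_conductorNorm_iff_not_hasGoodReductionAtPrime p).mpr (not_good_of_addv W p hloc.2.1)
  have hsplit : SplitsIn K p := hHe p hp (hN ▸ hpN)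
  -- a frame: anticyclotomic `κ`, topological generator `γ`, degree-one `𝔭 ∣ p`
  obtain ⟨κ, γ, -, hκ, hγ, -⟩ := X11b.exists_anticyclotomic_generator_prime (p := p) hK
  haveI : Fact (κ.IsTopGenerator γ) := ⟨hγ⟩
  obtain ⟨𝔭, h𝔭, he, hf⟩ := X11b.exists_degreeOnePrime_of_splitsIn K p hK.1 hsplit
  -- the bookkeeping at that frame
  have hineq := index_le_slack_of_additive_links (h1 κ hκ γ 𝔭 h𝔭 he hf) (h2 κ hκ γ 𝔭 h𝔭 he hf)
  -- Tamagawa transport (every `p`) and `Ш[p^∞]` vs `Ш` for finite `Ш`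
  have htam1 := X11b.padicValNat_tamagawaProductSplit_eq_of_heegner_prime W K p hN hHe
  have htam2 := X11b.padicValNat_tamagawaProduct_baseChange_of_heegner_prime W K p hK hN hHe
  haveI : Finite (W.baseChange K).sha := hfin
  have hsha : padicValNat p (Nat.card (AddCommGroup.primaryComponent (W.baseChange K).sha p)) =
      padicValNat p (W.baseChange K).shaOrder := by
    rw [Literature.NumberTheory.EllipticCurves.natCard_primaryComponent_eq_pow_padicValNat p,
      padicValNat.prime_pow]
    rfl
  unfold IndexLowerBoundLeAt
  rw [htam1, htam2, hsha] at hineq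
  omega

/-- **The link, modulo Kolyvagin.** Kolyvagin's finiteness of `Ш(E/K)` at a non-torsion Heegner point
(the `kolyvagin` conjunct of the route's `PrintedFacts`) and the three cruxes `PotMultBranchIMC`
(cell (M)), `GordTwoBranchIMC` (cell (G-ord, `e = 2`)), `AnticycControlAdditive` give the target
`StepLManin` BY NAME. [cite: JetchevSkinnerWan2017, §7.4.1 (arXiv p. 30)] [cite: Gross1991, Thm. 1.3] -/
theorem stepLManin_of_kolyvagin_of_cruxes
    (hKo : ∀ (N : ℕ) [NeZero N] (W : WeierstrassCurve ℚ) (K : Type) [Field K] [NumberField K],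
      Literature.NumberTheory.EllipticCurves.kolyvagin N W K)
    (h2 : Summit.BirchSwinnertonDyer.BirchSwinnertonDyer.Theses.SchneiderFreeAdditiveX3.PotMultBranchIMC)
    (h3 : Summit.BirchSwinnertonDyer.BirchSwinnertonDyer.Theses.SchneiderFreeAdditiveX3.GordTwoBranchIMC)
    (h4 : Summit.BirchSwinnertonDyer.BirchSwinnertonDyer.Theses.SchneiderFreeAdditiveX3.AnticycControlAdditive) :
    Summit.BirchSwinnertonDyer.BirchSwinnertonDyer.Theses.SchneiderFreeAdditiveX3.StepLManin := by
  intro W _ _ p _ hr hp2 hX hS N _ K _ _ Dt H ι P hr' hloc hN hK hodd hunit hHe hL hP hnt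
  have hfin : (W.baseChange K).ShaFinite := (hKo N W K hK hHe ⟨Dt, H, ι, hP⟩ hnt).2
  refine indexLowerBoundLeAt_of_frames_of_shaFinite hloc hN hK hHe hfin ?_ ?_
  · intro κ hκ γ _ 𝔭 h𝔭 he hf
    rcases hS with hM | hG
    · exact h2 W p hr hp2 hX hM N K Dt H ι P hr' hloc hN hK hodd hunit hHe hL hP hnt κ hκ γ 𝔭 h𝔭 he hf
    · exact h3 W p hr hp2 hX hG N K Dt H ι P hr' hloc hN hK hodd hunit hHe hL hP hnt κ hκ γ 𝔭 h𝔭 he hf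
  · intro κ hκ γ _ 𝔭 h𝔭 he hf
    exact h4 W p hr hp2 hX hS N K Dt H ι P hr' hloc hN hK hodd hunit hHe hL hP hnt κ hκ γ 𝔭 h𝔭 he hf

/-- **`StepLManinLink` modulo Kolyvagin**: the route's support item 19179 BY NAME, under the Kolyvagin
conjunct of `PrintedFacts`. [cite: Gross1991, Thm. 1.3] [cite: JetchevSkinnerWan2017, §7.4.1 (arXiv p. 30)] -/
theorem stepLManinLink_of_kolyvagin
    (hKo : ∀ (N : ℕ) [NeZero N] (W : WeierstrassCurve ℚ) (K : Type) [Field K] [NumberField K],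
      Literature.NumberTheory.EllipticCurves.kolyvagin N W K) :
    Summit.BirchSwinnertonDyer.BirchSwinnertonDyer.Theses.SchneiderFreeAdditiveX3.StepLManinLink :=
  fun h2 h3 h4 ↦ stepLManin_of_kolyvagin_of_cruxes hKo h2 h3 h4

/-- **The (M) half alone (this seat's crux)**: Kolyvagin + `PotMultBranchIMC` + `AnticycControlAdditive`
give STEP L (Manin-robust) on the potentially multiplicative reducible cell, i.e. `StepLManin`
restricted to `SubM`. [cite: JetchevSkinnerWan2017, §7.4.1 (arXiv p. 30)] [cite: Gross1991, Thm. 1.3] -/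
theorem additiveStepLInputManinAt_of_kolyvagin_of_potMult_of_control
    (hKo : ∀ (N : ℕ) [NeZero N] (W : WeierstrassCurve ℚ) (K : Type) [Field K] [NumberField K],
      Literature.NumberTheory.EllipticCurves.kolyvagin N W K)
    (h2 : Summit.BirchSwinnertonDyer.BirchSwinnertonDyer.Theses.SchneiderFreeAdditiveX3.PotMultBranchIMC)
    (h4 : Summit.BirchSwinnertonDyer.BirchSwinnertonDyer.Theses.SchneiderFreeAdditiveX3.AnticycControlAdditive) :
    ∀ (W : WeierstrassCurve ℚ) [W.IsElliptic] [W.IsGloballyMinimal] (p : ℕ) [Fact p.Prime],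
      W.analyticRank = 1 → p ≠ 2 → ClassX3 W p → Additive.SubM W p →
        AdditiveStepLInputManinAt W p := by
  intro W _ _ p _ hr hp2 hX hM N _ K _ _ Dt H ι P hr' hloc hN hK hodd hunit hHe hL hP hnt
  have hfin : (W.baseChange K).ShaFinite := (hKo N W K hK hHe ⟨Dt, H, ι, hP⟩ hnt).2
  have hS : Additive.SubSemistableTwist W p := Or.inl hM
  refine indexLowerBoundLeAt_of_frames_of_shaFinite hloc hN hK hHe hfin ?_ ?_
  · intro κ hκ γ _ 𝔭 h𝔭 he hf
    exact h2 W p hr hp2 hX hM N K Dt H ι P hr' hloc hN hK hodd hunit hHe hL hP hnt κ hκ γ 𝔭 h𝔭 he hf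
  · intro κ hκ γ _ 𝔭 h𝔭 he hf
    exact h4 W p hr hp2 hX hS N K Dt H ι P hr' hloc hN hK hodd hunit hHe hL hP hnt κ hκ γ 𝔭 h𝔭 he hf

end Summit.BirchSwinnertonDyer.BirchSwinnertonDyer.Theorems.SchneiderFree

end
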